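import Literature.Topology.FourManifolds.TautFoliationsRingParam
import Literature.Topology.FourManifolds.TautFoliationsCollarRings
import Mathlib.Data.Finset.Sort
import HarnessLib

/-!
# The crossings of a ring with the 1-skeleton of the grid

Topic: the coned fence collar, plan (d) F2. For the grid of `closedBall c₀ L` and a radius `R`
**generic with respect to the grid lines** (no grid abscissa or ordinate at distance exactly `R`
from the corresponding coordinate of `c₀`), the ring `sphere c₀ R` meets the 1-skeleton
`⋃_Q ∂Q` in finitely many points (`finite_sphere_inter_skeleton`); the angular parametrisation
`ringParam` being injective on `[0, 1)`, its crossing parameters form a finite set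
(`finite_crossings`) which we enumerate increasingly as `0 = θ₀ < θ₁ < ⋯ < θ_N = 1` when `0` is a
crossing (`exists_crossing_enumeration`); between two consecutive crossing parameters the ring
runs in one closed grid square (`exists_sq_of_consecutive`).

* `Grid.skeleton` (**definition**), `finite_sphere_inter_skeleton`, `injOn_ringParam`,
  `finite_crossings`, `exists_crossing_enumeration`, `exists_sq_of_consecutive` (**proved**).

All statements are [folklore].
-/

noncomputable section

open Set Filter Metric Topology Function Real
open scoped unitInterval

namespace Literature.Topology.FourManifolds

namespace SquareGrid.Grid

variable (g : Grid)

/-- **The 1-skeleton** of the grid: the union of the boundaries of the squares. [folklore] -/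
def skeleton : Set (ℝ × ℝ) := ⋃ q : Fin g.n × Fin g.n, sphere (g.centre q) g.ℓ

/-- Membership in the skeleton. [folklore] -/
theorem mem_skeleton_iff {x : ℝ × ℝ} : x ∈ g.skeleton ↔ ∃ q, x ∈ sphere (g.centre q) g.ℓ := mem_iUnion

/-- The skeleton is closed. [folklore] -/
theorem isClosed_skeleton : IsClosed g.skeleton := isClosed_iUnion_of_finite fun _ ↦ isClosed_sphere

/-- The grid abscissae and ordinates. [folklore] -/
def lines₁ : Set ℝ := (fun i : Fin (g.n + 1) ↦ g.a.1 + 2 * (i : ℕ) * g.ℓ) '' univ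

/-- The grid ordinates. [folklore] -/
def lines₂ : Set ℝ := (fun i : Fin (g.n + 1) ↦ g.a.2 + 2 * (i : ℕ) * g.ℓ) '' univ

/-- There are finitely many grid abscissae. [folklore] -/
theorem finite_lines₁ : g.lines₁.Finite := (finite_univ (α := Fin (g.n + 1))).image _

/-- There are finitely many grid ordinates. [folklore] -/
theorem finite_lines₂ : g.lines₂.Finite := (finite_univ (α := Fin (g.n + 1))).image _

/-- A point of the skeleton has a grid abscissa or a grid ordinate. [folklore] -/
theorem fst_mem_lines_or_of_mem_skeleton {x : ℝ × ℝ} (hx : x ∈ g.skeleton) : x.1 ∈ g.lines₁ ∨ x.2 ∈ g.lines₂ := by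
  obtain ⟨q, hq⟩ := (g.mem_skeleton_iff).1 hx
  rcases ((g.mem_sphere_centre_iff).1 hq).2 with h | h | h | h
  · exact Or.inl ⟨⟨q.1, by omega⟩, mem_univ _, by rw [h]⟩
  · refine Or.inl ⟨⟨(q.1 : ℕ) + 1, by omega⟩, mem_univ _, ?_⟩
    rw [h]; push_cast; ring
  · exact Or.inr ⟨⟨q.2, by omega⟩, mem_univ _, by rw [h]⟩
  · refine Or.inr ⟨⟨(q.2 : ℕ) + 1, by omega⟩, mem_univ _, ?_⟩
    rw [h]; push_cast; ring

end SquareGrid.Grid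

namespace SquarePolar

open SquareGrid SquareGrid.Grid

variable {c₀ : ℝ × ℝ} {L R : ℝ}

/-- **Generic rings meet the skeleton in finitely many points**: if no grid abscissa (resp.
ordinate) is at distance exactly `R` from that of `c₀`, then `sphere c₀ R ∩ skeleton` is finite.
[folklore] -/
theorem finite_sphere_inter_skeleton (g : Grid) (h₁ : ∀ A ∈ g.lines₁, |A - c₀.1| ≠ R) (h₂ : ∀ A ∈ g.lines₂, |A - c₀.2| ≠ R) :
    (sphere c₀ R ∩ g.skeleton).Finite := by
  -- the candidate points
  set C : Set (ℝ × ℝ) := ((fun p : ℝ × Bool ↦ (p.1, c₀.2 + (if p.2 then R else -R))) '' (g.lines₁ ×ˢ univ)) ∪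
    ((fun p : ℝ × Bool ↦ (c₀.1 + (if p.2 then R else -R), p.1)) '' (g.lines₂ ×ˢ univ)) with hC
  have hCfin : C.Finite := ((g.finite_lines₁.prod finite_univ).image _).union ((g.finite_lines₂.prod finite_univ).image _)
  refine hCfin.subset fun x hx ↦ ?_
  obtain ⟨hxS, hxk⟩ := hx
  have hd : max |x.1 - c₀.1| |x.2 - c₀.2| = R := by
    have := mem_sphere.1 hxS; rwa [Prod.dist_eq, Real.dist_eq, Real.dist_eq] at this
  rcases g.fst_mem_lines_or_of_mem_skeleton hxk with hl | hl
  · -- grid abscissa: the ordinate is `c₀.2 ± R`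
    left
    have hne := h₁ x.1 hl
    have h2 : |x.2 - c₀.2| = R := by
      rcases max_eq_iff.1 hd with ⟨h, -⟩ | ⟨h, -⟩
      · exact absurd h hne
      · exact h
    rcases (abs_eq (by have := abs_nonneg (x.2 - c₀.2); rw [h2] at this; exact this)).1 h2 with h | h
    · exact ⟨(x.1, true), ⟨hl, mem_univ _⟩, by ext <;> simp; linarith⟩
    · exact ⟨(x.1, false), ⟨hl, mem_univ _⟩, by ext <;> simp; linarith⟩
  · right
    have hne := h₂ x.2 hl
    have h2 : |x.1 - c₀.1| = R := by
      rcases max_eq_iff.1 hd with ⟨h, -⟩ | ⟨h, -⟩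
      · exact h
      · exact absurd h hne
    rcases (abs_eq (by have := abs_nonneg (x.1 - c₀.1); rw [h2] at this; exact this)).1 h2 with h | h
    · exact ⟨(x.2, true), ⟨hl, mem_univ _⟩, by ext <;> simp; linarith⟩
    · exact ⟨(x.2, false), ⟨hl, mem_univ _⟩, by ext <;> simp; linarith⟩

/-- The ring parametrisation is injective on `[0, 1)` (positive radius). [folklore] -/
theorem injOn_ringParam (hR : 0 < R) : InjOn (ringParam c₀ R) (Ico 0 1) := fun θ hθ θ' hθ' h ↦ by
  have h1 := angleParam_ringParam (c₀ := c₀) hR hθ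
  have h2 := angleParam_ringParam (c₀ := c₀) hR hθ'
  rw [← h1, ← h2, h]

/-- **The crossing parameters are finitely many.** [folklore] -/
theorem finite_crossings (g : Grid) (hR : 0 < R) (h₁ : ∀ A ∈ g.lines₁, |A - c₀.1| ≠ R) (h₂ : ∀ A ∈ g.lines₂, |A - c₀.2| ≠ R) :
    {θ : ℝ | θ ∈ Icc (0 : ℝ) 1 ∧ ringParam c₀ R θ ∈ g.skeleton}.Finite := by
  have hfin := finite_sphere_inter_skeleton (c₀ := c₀) (R := R) g h₁ h₂
  have hsub : {θ : ℝ | θ ∈ Icc (0 : ℝ) 1 ∧ ringParam c₀ R θ ∈ g.skeleton} ⊆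
      ({θ | θ ∈ Ico (0 : ℝ) 1 ∧ ringParam c₀ R θ ∈ sphere c₀ R ∩ g.skeleton}) ∪ {1} := by
    intro θ ⟨hθ, hk⟩
    rcases hθ.2.lt_or_eq with hlt | heq
    · exact Or.inl ⟨⟨hθ.1, hlt⟩, mem_sphere.2 (dist_ringParam hR.le θ), hk⟩
    · exact Or.inr heq
  refine Finite.subset (Finite.union ?_ (finite_singleton 1)) hsub
  exact Finite.of_finite_image (hfin.subset (by rintro _ ⟨θ, ⟨-, h⟩, rfl⟩; exact h))
    ((injOn_ringParam hR).mono fun θ hθ ↦ hθ.1)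

/-- **Increasing enumeration of the crossing parameters**, when `0` is a crossing. [folklore] -/
theorem exists_crossing_enumeration (g : Grid) (hR : 0 < R) (h₁ : ∀ A ∈ g.lines₁, |A - c₀.1| ≠ R)
    (h₂ : ∀ A ∈ g.lines₂, |A - c₀.2| ≠ R) (h0 : ringParam c₀ R 0 ∈ g.skeleton) :
    ∃ (N : ℕ) (θs : Fin (N + 1) → ℝ), StrictMono θs ∧ θs 0 = 0 ∧ θs (Fin.last N) = 1 ∧
      (∀ j, ringParam c₀ R (θs j) ∈ g.skeleton) ∧ (∀ j, θs j ∈ Icc (0 : ℝ) 1) ∧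
      ∀ θ ∈ Icc (0 : ℝ) 1, ringParam c₀ R θ ∈ g.skeleton → ∃ j, θs j = θ := by
  classical
  set Θ : Set ℝ := {θ : ℝ | θ ∈ Icc (0 : ℝ) 1 ∧ ringParam c₀ R θ ∈ g.skeleton} with hΘ
  have hfin : Θ.Finite := finite_crossings g hR h₁ h₂
  set T : Finset ℝ := hfin.toFinset with hT
  have hmemT : ∀ {θ}, θ ∈ T ↔ θ ∈ Θ := fun {θ} ↦ hfin.mem_toFinset
  have h0T : (0 : ℝ) ∈ T := hmemT.2 ⟨⟨le_rfl, zero_le_one⟩, h0⟩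
  have h1T : (1 : ℝ) ∈ T := hmemT.2 ⟨⟨zero_le_one, le_rfl⟩, by rw [ringParam_one]; exact h0⟩
  have hcard : 0 < T.card := Finset.card_pos.2 ⟨0, h0T⟩
  obtain ⟨N, hN⟩ : ∃ N : ℕ, T.card = N + 1 := ⟨T.card - 1, by omega⟩
  set θs : Fin (N + 1) → ℝ := fun j ↦ T.orderEmbOfFin hN j with hθs
  have hmono : StrictMono θs := (T.orderEmbOfFin hN).strictMono
  have hmem : ∀ j, θs j ∈ Θ := fun j ↦ hmemT.1 (T.orderEmbOfFin_mem hN j)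
  have hmin : θs 0 = 0 := by
    show T.orderEmbOfFin hN ⟨0, by omega⟩ = 0
    rw [Finset.orderEmbOfFin_zero hN (by omega)]
    refine le_antisymm (Finset.min'_le T 0 h0T) ?_
    exact Finset.le_min' T ⟨0, h0T⟩ 0 fun θ hθ ↦ (hmemT.1 hθ).1.1
  have hmax : θs (Fin.last N) = 1 := by
    show T.orderEmbOfFin hN ⟨N, by omega⟩ = 1
    have h := Finset.orderEmbOfFin_last hN (by omega)
    simp only [show N + 1 - 1 = N from rfl] at h
    rw [h]
    refine le_antisymm ?_ (Finset.le_max' T 1 h1T)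
    exact Finset.max'_le T ⟨1, h1T⟩ 1 fun θ hθ ↦ (hmemT.1 hθ).1.2
  refine ⟨N, θs, hmono, hmin, hmax, fun j ↦ (hmem j).2, fun j ↦ (hmem j).1, fun θ hθ hk ↦ ?_⟩
  have hθT : θ ∈ T := hmemT.2 ⟨hθ, hk⟩
  have hrange : θ ∈ Set.range (T.orderEmbOfFin hN) := by rw [Finset.range_orderEmbOfFin]; exact hθT
  obtain ⟨j, hj⟩ := hrange
  exact ⟨j, hj⟩

/-- **Between consecutive crossing parameters the ring runs in one closed square** (for
`R ≤ L`, grid of `closedBall c₀ L`). [folklore] -/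
theorem exists_sq_of_consecutive (hL : 0 < L) {n : ℕ} (hn : 0 < n) (hR : 0 < R) (hRL : R ≤ L) {θ₁ θ₂ : ℝ} (h12 : θ₁ < θ₂)
    (hno : ∀ θ ∈ Ioo θ₁ θ₂, ringParam c₀ R θ ∉ (Foliation.grid c₀ hL hn).skeleton) :
    ∃ q, ringParam c₀ R '' Icc θ₁ θ₂ ⊆ (Foliation.grid c₀ hL hn).sq q := by
  set g := Foliation.grid c₀ hL hn with hg
  have hS : ∀ θ, ringParam c₀ R θ ∈ g.S := fun θ ↦ by
    rw [show g.S = closedBall c₀ L from Foliation.grid_S hL hn, mem_closedBall, dist_ringParam hR.le]; exact hRL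
  -- the open square containing the ring point, for parameters strictly between
  have hball : ∀ θ ∈ Ioo θ₁ θ₂, ∃ q, ringParam c₀ R θ ∈ ball (g.centre q) g.ℓ := fun θ hθ ↦ by
    obtain ⟨q, hq⟩ := g.exists_mem_sq (hS θ)
    refine ⟨q, ?_⟩
    rcases (mem_closedBall.1 hq).lt_or_eq with hlt | heq
    · exact mem_ball.2 hlt
    · exact absurd ((g.mem_skeleton_iff).2 ⟨q, mem_sphere.2 heq⟩) (hno θ hθ)
  classical
  haveI : Nonempty (Fin g.n × Fin g.n) := ⟨(⟨0, hn⟩, ⟨0, hn⟩)⟩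
  choose! qf hqf using hball
  -- `qf` is locally constant on the interval, hence constant
  have hcont : ContinuousOn qf (Ioo θ₁ θ₂) := by
    intro θ hθ
    have hopen : IsOpen ((ringParam c₀ R) ⁻¹' ball (g.centre (qf θ)) g.ℓ) := isOpen_ball.preimage (continuous_ringParam c₀ R)
    have hev : ∀ᶠ θ' in 𝓝[Ioo θ₁ θ₂] θ, qf θ' = qf θ := by
      have h1 : ∀ᶠ θ' in 𝓝[Ioo θ₁ θ₂] θ, ringParam c₀ R θ' ∈ ball (g.centre (qf θ)) g.ℓ :=
        nhdsWithin_le_nhds (hopen.mem_nhds (hqf θ hθ))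
      have h2 : ∀ᶠ θ' in 𝓝[Ioo θ₁ θ₂] θ, θ' ∈ Ioo θ₁ θ₂ := self_mem_nhdsWithin
      filter_upwards [h1, h2] with θ' hθ' hθ'I
      exact g.eq_of_mem_ball_of_mem_ball hθ' (hqf θ' hθ'I)
    exact (continuousWithinAt_const (b := qf θ)).congr_of_eventuallyEq hev rfl
  have hconst : ∀ θ ∈ Ioo θ₁ θ₂, ∀ θ' ∈ Ioo θ₁ θ₂, qf θ = qf θ' := fun θ hθ θ' hθ' ↦
    isPreconnected_Ioo.constant hcont hθ hθ'
  -- the midpoint index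
  set θm := (θ₁ + θ₂) / 2 with hθm
  have hθmI : θm ∈ Ioo θ₁ θ₂ := ⟨by rw [hθm]; linarith, by rw [hθm]; linarith⟩
  refine ⟨qf θm, ?_⟩
  -- the open interval maps into the closed square, and so does its closure
  have hIoo : ringParam c₀ R '' Ioo θ₁ θ₂ ⊆ g.sq (qf θm) := by
    rintro _ ⟨θ, hθ, rfl⟩
    rw [← hconst θ hθ θm hθmI]
    exact ball_subset_closedBall (hqf θ hθ)
  have hcl : ringParam c₀ R '' Icc θ₁ θ₂ ⊆ closure (ringParam c₀ R '' Ioo θ₁ θ₂) := by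
    rw [← closure_Ioo h12.ne]
    exact image_closure_subset_closure_image (continuous_ringParam c₀ R)
  exact hcl.trans (closure_minimal hIoo isClosed_closedBall)

end SquarePolar

end Literature.Topology.FourManifolds
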